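import Summits.BirchSwinnertonDyer.BirchSwinnertonDyer.Theorems.GenusKolyvaginAtTwoGenusPrimitiveSupplyAtTwoPosDiscShallowKFourPosCellTrichotomy
import Summits.BirchSwinnertonDyer.BirchSwinnertonDyer.Theorems.GenusKolyvaginAtTwoGenusPrimitiveSupplyAtTwoPosDiscShallowKFourPosCellShaTwoRank
import Summits.BirchSwinnertonDyer.BirchSwinnertonDyer.Theorems.GenusKolyvaginAtTwoGenusPrimitiveSupplyAtTwoPrimeTwistRigidity
import Summits.BirchSwinnertonDyer.BirchSwinnertonDyer.Theorems.GenusKolyvaginAtTwoGenusPrimitiveSupplyAtTwoPrimeTwistDescAdmissible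
import Summits.BirchSwinnertonDyer.BirchSwinnertonDyer.Theorems.GenusKolyvaginAtTwoGenusPrimitiveSupplyAtTwoQuadraticCharacterExists
import Summits.BirchSwinnertonDyer.BirchSwinnertonDyer.Theorems.GenusKolyvaginAtTwoEquivariantKolyvaginExactAtTwoEigenClassesFinite
import Summits.BirchSwinnertonDyer.BirchSwinnertonDyer.Theorems.GenusKolyvaginAtTwoGenusPrimitiveSupplyAtTwoShaPlaneDoorTwin
import Literature.NumberTheory.EllipticCurves.ShaRestriction
import Literature.NumberTheory.EllipticCurves.ArchimedeanLocalConditionTorsion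
import Literature.NumberTheory.EllipticCurves.CasselsTateSelmerKolyvaginValue
import Literature.NumberTheory.EllipticCurves.PrimeConductorTwoTorsionNormalFormProofs
import Summits.BirchSwinnertonDyer.BirchSwinnertonDyer.Theorems.ByReductionTypeAtTwoRankOneAtTwoBigImageOddLocalOneDoorBottomLeavesLines
import HarnessLib

/-!
# Route `GenusKolyvaginAtTwo`, residual `OffCutResidualAtTwoR` (stmt-BirchSwinnertonDyer-31767), LINE 27 «socle_selection» STUB S2, conjunct (SOC) —
# THE REAL-TRIVIAL LINE OF `Sel₂(E/ℚ)` IS THE TWIN'S SELMER GROUP, IS THE CAPITULATION KERNEL, AND NARROWNESS IS AUTOMATIC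
# (shallow `Δ > 0` Heegner frame, `2` split in `K`)

LEAD seat `bsd-line-gk2-p1` g25 (cell `bsd-f1-sign2`), `--supports stmt-BirchSwinnertonDyer-31767 --as helper`.  THEOREMS ONLY (no definition, no named
fact, no `sorry`).  **BSD is NOT proved by this file; `OffCutResidualAtTwoR`, K4Pos and crux 25504 are NOT proved; S2 is NOT closed (its (HL)
conjunct remains, and this file carries the extra clause «`2` split in `K`» — see the end of this docstring).**

THE FRAME (= the K₄⁺ cell of crux 25504 minus every Heegner-datum binder): `E/ℚ` globally minimal, `Δ_E > 0`, `ρ̄_{E,2}` onto, odd Tamagawa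
product, `#Sel₂(E/ℚ) = 4`; `K` imaginary quadratic with odd `d_K`, Heegner for `N_E`, `2` SPLIT in `K`; a globally minimal twin
`Wd = Cd • E^{(d_K)}` with `ord₂ C(Wd) = 0` (SHALLOW) and `#Sel₂(Wd/ℚ) = 2`.  Write `χ = χ_{d_K}`, `T := Sel_𝔓(A_χ/ℚ) ⊆ H¹(ℚ, E[2])` (Mazur–Rubin's
prime-twist Selmer group, `≅ Sel₂(Wd/ℚ)` by gk2-p5's model dictionary), `S := Sel₂(E/ℚ)`, `S₀ := {s ∈ S : loc_∞ s = 0}` (the REAL-TRIVIAL line).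

* §1 `resTorsion_mem_range_kummerMapTorsion_of_mem_selmerLocalKer` — bookkeeping for ANY `E/K₀`, `L/K₀`: a class of `H¹(K₀, E[n])` in the tree's
  «local» kernel at the GLOBAL field `L` restricts into the Kummer image `κ(E(L))` (Kummer exactness over `L`).
* §2 **`twistSelmer_eq_strict_and_narrow`** — on the frame: `d_K` is descent-admissible (gk2-p5 `descAdmissible_discr_of_allSilentTwin`), so by gk2-p5's
  DECISION `primeTwist_selmerGroup_eq_relaxed_or_eq_kummerStrict_decided` EITHER `T = Sel₂^{rel ∞}(E) ⊇ S` (order `≥ 4`) OR [`S` is real-NARROW and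
  `T = Sel₂^{str ∞}(E)`]; the first is absurd since `#T = #Sel₂(Wd) = 2`.  Hence **(A1) NARROWNESS IS AUTOMATIC** (`exists_localization_ne_zero_of_shallowTwin`:
  the K₄⁺ cut clause `∃ c ∈ Sel₂(E), loc_∞ c ≠ 0` of `GenusPrimitiveSupplyAtTwoPosDiscShallow` / K4Pos is IMPLIED by the rest of the frame) and
  **(A2)** `T = S₀` has exactly two elements (`realTrivial_iff_mem_primeTwist_selmerGroup`, `natCard_realTrivial_eq_two`).
* §3 **(A3) THE REAL-TRIVIAL LINE CAPITULATES** (`resTorsion_mem_range_kummer_of_realTrivial`): for `s ∈ S` real-trivial, `res_K s ∈ κ₂(E(K))`.  Mechanism: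
  `s ∈ T`; gk2-p5's ELEMENT-LEVEL dictionary `exists_primeTwistModel_dictionary` gives `s = ψ_* x` with `x ∈ Sel₂(Wd) = κ(Wd(ℚ))` (rank `1`, no
  `2`-torsion, `#Sel₂ = 2`) and transports the «local» kernel at the GLOBAL field `F = K` (where `χ` is trivial: `primeTwist_selmerLocalKer_eq_of_exists_sq`),
  so `s ∈ E.selmerLocalKer K 2`, i.e. `res_K s` dies in `H¹(K, E)` (§1).  With `rank E(K) = 1` and `E(K)[2] = 0`: `res_K s = κ₂(Q₀)` for ANY `Q₀ ∉ 2E(K)`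
  (`resTorsion_eq_kummer_of_realTrivial`), and conversely the UNIQUE descent `s_y` of `κ₂(Q₀)` (gk2-p5 `KFourPosCell`, p767715) is real-trivial
  (`realTrivial_of_resTorsion_eq_kummer`): **capitulation kernel = real-trivial line = twin's Selmer group**.
This is LEAD-BRIEF-g24 §6's decomposition of (SOC) made kernel; the Heegner bookkeeping «socle of the Heegner line = ι κ₂(y_K/2^{M₀})» that turns (A3)
into S2's (SOC) VERBATIM is the sequel file.  ON «`2` SPLIT»: S2's frame as typed allows `d_K ≡ 5 (8)`; there the prime-twist dictionary at the inert
place `2` (Mazur–Rubin 2010 Lemma 2.10 (v) at `v = 2`) is NOT in the tree — the prime-frame suppliers of 25504 deliver `2` split, so the pen may add the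
clause to `hP`'s output at no cost.  BSD is NOT proved by any of this.

References: [Kramer1981] Thm. 1, Prop. 3, Prop. 7; [MazurRubin2010] Def. 3.1, Lemma 3.2, Prop. 3.3; [MazurRubin2007] §3, Prop. 4.1, Def. 4.3;
[GrossLMS1991] §5 (5.1); [SilvermanAEC2009] VIII.§2, Thm. X.4.2.
-/

set_option autoImplicit false
-- the Theorems namespace of this sub repeats the summit name by design (D-0017 nested layout)
set_option linter.dupNamespace false

noncomputable section

open scoped Classical

namespace Summit.BirchSwinnertonDyer.BirchSwinnertonDyer.Theorems.GenusExact.PlusDescent.SocleSelection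

open WeierstrassCurve NumberField IsDedekindDomain Field
open Literature.NumberTheory.EllipticCurves Literature.NumberTheory.GaloisRepresentations
open Summit.BirchSwinnertonDyer.Rank1Residual.F1Sign2 (DescAdmissible NoRationalTwoTorsion IsQuadraticCharacterOf
  selmerGroupRelaxedAtInfinityAtTwo selmerGroup_le_selmerGroupRelaxedAtInfinityAtTwo mem_selmerGroupRelaxedAtInfinityAtTwo_iff)
open Summit.BirchSwinnertonDyer.Rank1Residual.X11b.KummerPT (kummerStrict)
open Summit.BirchSwinnertonDyer.BirchSwinnertonDyer.Theorems.GenusKolyArch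
open Summit.BirchSwinnertonDyer.BirchSwinnertonDyer.Theorems.GenusSupplyNarrow.KFourPosCell
open Summit.BirchSwinnertonDyer.BirchSwinnertonDyer.Theorems.RankOneAtTwoOneDoor (mem_torsionLocalKer_completion_iff)

/-! ## §1 A class in the «local» kernel at a GLOBAL field restricts into the Kummer image there -/

section Bookkeeping

universe u

variable {K₀ : Type u} [Field K₀] (V : WeierstrassCurve K₀) (L : Type u) [Field L] [NumberField L] [Algebra K₀ L]

/-- **`t ∈ selmerLocalKer V L n` (the tree's local kernel, taken AT THE GLOBAL FIELD `L`) ⟹ `res_L t ∈ κ_n(V(L))`.**  The local kernel at `L` is the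
preimage of `ker(H¹(K₀, V) → H¹(L, V_L))` (`mem_selmerLocalKer_iff_torsionH1ToH1_mem`, `mem_ker_resBaseChange_iff`); restriction commutes with
`H¹(·, V[n]) → H¹(·, V)` (`torsionH1ToH1_resTorsion`); Kummer exactness over `L` (`mem_range_kummerMapTorsion_of_torsionH1ToH1_eq_zero`).
[cite: SilvermanAEC2009, VIII.§2 and X.§4] -/
theorem resTorsion_mem_range_kummerMapTorsion_of_mem_selmerLocalKer (n : ℤ)
    (hdiv : ∀ P : geomPoints (V.baseChange L), ∃ Q : geomPoints (V.baseChange L), n • Q = P)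
    {t : galH1Torsion V n} (ht : t ∈ selmerLocalKer V L n) :
    resTorsion V L n t ∈ (kummerMapTorsion (V.baseChange L) n hdiv).range := by
  haveI : CharZero L := inferInstance
  haveI : PerfectField L := PerfectField.ofCharZero
  have h1 : torsionH1ToH1 V n t ∈ V.localRestrictionKer L := (mem_selmerLocalKer_iff_torsionH1ToH1_mem V L t).mp ht
  have h2 : resBaseChange V L (torsionH1ToH1 V n t) = 0 := (mem_ker_resBaseChange_iff V L _).mpr h1
  have h3 : torsionH1ToH1 (V.baseChange L) n (resTorsion V L n t) = 0 := by rw [torsionH1ToH1_resTorsion, h2]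
  exact mem_range_kummerMapTorsion_of_torsionH1ToH1_eq_zero (V.baseChange L) n hdiv _ h3

end Bookkeeping

/-! ## §2 On the shallow frame: `Sel_𝔓(A_χ) = Sel₂^{str ∞}(E)` of order `2`; narrowness is automatic -/

section Frame

variable (W : WeierstrassCurve ℚ) [W.IsElliptic] [W.IsGloballyMinimal] {K : Type} [Field K] [NumberField K]

/-- The `ℤ`-cast of `2` used by the tree's Selmer groups is `((2 : ℕ) : ℤ)`. [folklore] -/
private theorem two_eq : (2 : ℤ) = ((2 : ℕ) : ℤ) := rfl

/-- **THE DECISION ON THE SHALLOW FRAME.**  `E/ℚ` globally minimal, `Δ > 0`, `ρ̄_{E,2}` onto, `C(E)` odd, `#Sel₂(E) = 4`; `K` imaginary quadratic, odd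
`d_K`, Heegner, `2` split; `Wd = Cd • E^{(d_K)}` elliptic with `ord₂ C(Wd) = 0` and `#Sel₂(Wd) = 2`; `χ` the character of `K`.  Then
(i) some `2`-Selmer class of `E` is NON-trivial at `∞` and (ii) `Sel_𝔓(A_χ/ℚ) = Sel₂^{str ∞}(E)` (Kummer at the finite places, ZERO at `∞`).
Proof: `d_K` descent-admissible; gk2-p5's decision; the relaxed alternative has order `≥ #Sel₂(E) = 4 ≠ 2 = #Sel₂(Wd) = #Sel_𝔓(A_χ)`.
BSD is NOT proved by this.  [cite: Kramer1981, Thm. 1, Prop. 7] [cite: MazurRubin2010, Lemma 3.2, Prop 3.3] [cite: MazurRubin2007, §3, Prop 4.1, Def 4.3] -/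
theorem twistSelmer_eq_strict_and_narrow (hΔ : 0 < W.Δ) (hρ : W.HasSurjectiveModNGaloisRep 2) (hTam : Odd W.tamagawaProduct)
    (h4 : Nat.card (W.selmerGroup 2) = 4) (hK : IsImaginaryQuadratic K) (hodd : Odd (discr K))
    [NeZero (W.conductorNorm ℤ)] (hH : SatisfiesHeegnerHypothesis (W.conductorNorm ℤ) K)
    (h2K : ((Ideal.span {(2 : ℤ)}).primesOver (𝓞 K)).ncard = 2)
    {Wd : WeierstrassCurve ℚ} [Wd.IsElliptic] (Cd : VariableChange ℚ) (hCd : Cd • W.quadraticTwist (discr K : ℚ) = Wd)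
    (hDEF : padicValNat 2 Wd.tamagawaProduct = 0) (hSel : Nat.card (Wd.selmerGroup 2) = 2)
    {χ : absoluteGaloisGroup ℚ →ₜ* Multiplicative (ZMod 2)} (hχ : IsQuadraticCharacterOf χ (discr K)) :
    (∃ c ∈ W.selmerGroup ((2 : ℕ) : ℤ),
        galoisCohomology.localization (W.torsionGaloisModule ((2 : ℕ) : ℤ)) (Sum.inl Rat.infinitePlace) 1 c ≠ 0) ∧
      PrimeTwist.selmerGroup W χ = (kummerStrict W 2 {(Sum.inl Rat.infinitePlace : Place ℚ)}).selmerGroup := by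
  have hd : DescAdmissible W (discr K) := descAdmissible_discr_of_allSilentTwin W hK hodd hH h2K hTam Cd hCd hDEF
  have hT : NoRationalTwoTorsion W :=
    GenusKolyTwin.noRationalTwoTorsion_of_hasSurjectiveModNGaloisRep W (by simpa using hρ)
  rcases primeTwist_selmerGroup_eq_relaxed_or_eq_kummerStrict_decided W hΔ hT hd hχ Rat.infinitePlace with ⟨-, hR⟩ | h
  · -- relaxed branch: `#Sel_𝔓 ≥ #Sel₂(E) = 4`, but `#Sel_𝔓 = #Sel₂(Wd) = 2`
    exfalso
    have hcard : Nat.card (PrimeTwist.selmerGroup W χ) = 2 := by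
      rw [natCard_primeTwist_selmerGroup_eq_natCard_selmerGroup_rat W (NumberField.discr_ne_zero K) hχ hCd]
      exact_mod_cast hSel
    have hle : W.selmerGroup ((2 : ℕ) : ℤ) ≤ PrimeTwist.selmerGroup W χ := by
      rw [hR]; exact selmerGroup_le_selmerGroupRelaxedAtInfinityAtTwo W
    haveI : Finite (PrimeTwist.selmerGroup W χ) := Nat.finite_of_card_ne_zero (by rw [hcard]; norm_num)
    have h4' : Nat.card (W.selmerGroup ((2 : ℕ) : ℤ)) = 4 := h4
    have hle' := AddSubgroup.card_le_of_le hle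
    rw [hcard, h4'] at hle'
    omega
  · exact h

/-- **(A1) NARROWNESS IS AUTOMATIC on the shallow frame** (`2` split): some `2`-Selmer class of `E` is non-trivial at `∞` — the second half of the K₄⁺
cut clause `#Sel₂(E) = 4 ∧ ∃ c ∈ Sel₂(E), loc_∞ c ≠ 0` of `GenusPrimitiveSupplyAtTwoPosDiscShallow` / `K4Pos` is IMPLIED by the rest of their frame
(χ exists by `GenusKolyTransp.quadraticCharacterExists_holds`).  BSD is NOT proved by this.
[cite: Kramer1981, Thm. 1, Prop. 7] [cite: MazurRubin2010, Lemma 3.2, Prop 3.3] -/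
theorem exists_localization_ne_zero_of_shallowTwin (hΔ : 0 < W.Δ) (hρ : W.HasSurjectiveModNGaloisRep 2) (hTam : Odd W.tamagawaProduct)
    (h4 : Nat.card (W.selmerGroup 2) = 4) (hK : IsImaginaryQuadratic K) (hodd : Odd (discr K))
    [NeZero (W.conductorNorm ℤ)] (hH : SatisfiesHeegnerHypothesis (W.conductorNorm ℤ) K)
    (h2K : ((Ideal.span {(2 : ℤ)}).primesOver (𝓞 K)).ncard = 2)
    {Wd : WeierstrassCurve ℚ} [Wd.IsElliptic] (Cd : VariableChange ℚ) (hCd : Cd • W.quadraticTwist (discr K : ℚ) = Wd)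
    (hDEF : padicValNat 2 Wd.tamagawaProduct = 0) (hSel : Nat.card (Wd.selmerGroup 2) = 2) :
    Nat.card (W.selmerGroup 2) = 4 ∧ ∃ c ∈ (W.kummerSelmerStructure ((2 : ℕ) : ℤ)).selmerGroup,
      galoisCohomology.localization (W.torsionGaloisModule ((2 : ℕ) : ℤ)) (Sum.inl Rat.infinitePlace) 1 c ≠ 0 := by
  obtain ⟨χ, hχ⟩ := GenusKolyTransp.quadraticCharacterExists_holds (discr K)
  obtain ⟨⟨c, hc, hne⟩, -⟩ := twistSelmer_eq_strict_and_narrow W hΔ hρ hTam h4 hK hodd hH h2K Cd hCd hDEF hSel hχ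
  refine ⟨h4, c, ?_, hne⟩
  rwa [← selmerGroup_eq_selmerGroup_kummerSelmerStructure]

/-- **(A2) THE REAL-TRIVIAL LINE IS THE TWIN'S SELMER GROUP**: on the shallow frame (`2` split), a class `s ∈ H¹(ℚ, E[2])` is a REAL-TRIVIAL `2`-Selmer
class of `E` (`s ∈ Sel₂(E)`, `s ∈ torsionLocalKer_∞`) iff `s ∈ Sel_𝔓(A_{χ_{d_K}}/ℚ)`.  BSD is NOT proved by this.
[cite: Kramer1981, Thm. 1, Prop. 7] [cite: MazurRubin2010, Def 3.1, Lemma 3.2] -/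
theorem realTrivial_iff_mem_primeTwist_selmerGroup (hΔ : 0 < W.Δ) (hρ : W.HasSurjectiveModNGaloisRep 2) (hTam : Odd W.tamagawaProduct)
    (h4 : Nat.card (W.selmerGroup 2) = 4) (hK : IsImaginaryQuadratic K) (hodd : Odd (discr K))
    [NeZero (W.conductorNorm ℤ)] (hH : SatisfiesHeegnerHypothesis (W.conductorNorm ℤ) K)
    (h2K : ((Ideal.span {(2 : ℤ)}).primesOver (𝓞 K)).ncard = 2)
    {Wd : WeierstrassCurve ℚ} [Wd.IsElliptic] (Cd : VariableChange ℚ) (hCd : Cd • W.quadraticTwist (discr K : ℚ) = Wd)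
    (hDEF : padicValNat 2 Wd.tamagawaProduct = 0) (hSel : Nat.card (Wd.selmerGroup 2) = 2)
    {χ : absoluteGaloisGroup ℚ →ₜ* Multiplicative (ZMod 2)} (hχ : IsQuadraticCharacterOf χ (discr K))
    (s : galH1Torsion W ((2 : ℕ) : ℤ)) :
    (s ∈ W.selmerGroup ((2 : ℕ) : ℤ) ∧ ∀ w : InfinitePlace ℚ, s ∈ W.torsionLocalKer w.Completion ((2 : ℕ) : ℤ)) ↔
      s ∈ PrimeTwist.selmerGroup W χ := by
  obtain ⟨-, hstrict⟩ := twistSelmer_eq_strict_and_narrow W hΔ hρ hTam h4 hK hodd hH h2K Cd hCd hDEF hSel hχ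
  -- the strict group: Kummer at finite places, zero at `∞`
  have hkey : s ∈ PrimeTwist.selmerGroup W χ ↔
      s ∈ selmerGroupRelaxedAtInfinityAtTwo W ∧
        galoisCohomology.localization (W.torsionGaloisModule ((2 : ℕ) : ℤ)) (Sum.inl Rat.infinitePlace) 1 s = 0 := by
    rw [hstrict]; exact mem_selmerGroup_kummerStrict_singleton_inl_iff W Rat.infinitePlace s
  -- `torsionLocalKer_∞ = ker loc_∞`
  have htk : ∀ w : InfinitePlace ℚ, s ∈ W.torsionLocalKer w.Completion ((2 : ℕ) : ℤ) ↔
      galoisCohomology.localization (W.torsionGaloisModule ((2 : ℕ) : ℤ)) (Sum.inl w) 1 s = 0 :=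
    fun w ↦ mem_torsionLocalKer_completion_iff W w two_ne_zero s
  rw [hkey]
  constructor
  · rintro ⟨hs, hinf⟩
    exact ⟨selmerGroup_le_selmerGroupRelaxedAtInfinityAtTwo W hs, (htk _).mp (hinf _)⟩
  · rintro ⟨hrel, h0⟩
    have hinf : ∀ w : InfinitePlace ℚ, s ∈ W.torsionLocalKer w.Completion ((2 : ℕ) : ℤ) := by
      intro w
      rw [Subsingleton.elim w Rat.infinitePlace]
      exact (htk _).mpr h0
    refine ⟨?_, hinf⟩
    -- Kummer at the finite places (relaxed) and trivial, hence Kummer, at `∞`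
    rw [mem_selmerGroup_iff]
    refine ⟨(mem_selmerGroupRelaxedAtInfinityAtTwo_iff W s).mp hrel, fun w ↦ ?_⟩
    exact W.torsionLocalKer_le_selmerLocalKer w.Completion ((2 : ℕ) : ℤ) (hinf w)

/-- **(A2, counted) the real-trivial `2`-Selmer classes of `E` are exactly TWO** on the shallow frame (`2` split): `#S₀ = #Sel_𝔓(A_χ) = #Sel₂(Wd) = 2`.
BSD is NOT proved by this. [cite: Kramer1981, Thm. 1] [cite: MazurRubin2007, §3, Prop 4.1, Def 4.3] -/
theorem natCard_realTrivial_eq_two (hΔ : 0 < W.Δ) (hρ : W.HasSurjectiveModNGaloisRep 2) (hTam : Odd W.tamagawaProduct)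
    (h4 : Nat.card (W.selmerGroup 2) = 4) (hK : IsImaginaryQuadratic K) (hodd : Odd (discr K))
    [NeZero (W.conductorNorm ℤ)] (hH : SatisfiesHeegnerHypothesis (W.conductorNorm ℤ) K)
    (h2K : ((Ideal.span {(2 : ℤ)}).primesOver (𝓞 K)).ncard = 2)
    {Wd : WeierstrassCurve ℚ} [Wd.IsElliptic] (Cd : VariableChange ℚ) (hCd : Cd • W.quadraticTwist (discr K : ℚ) = Wd)
    (hDEF : padicValNat 2 Wd.tamagawaProduct = 0) (hSel : Nat.card (Wd.selmerGroup 2) = 2) :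
    Nat.card {s : galH1Torsion W ((2 : ℕ) : ℤ) //
        s ∈ W.selmerGroup ((2 : ℕ) : ℤ) ∧ ∀ w : InfinitePlace ℚ, s ∈ W.torsionLocalKer w.Completion ((2 : ℕ) : ℤ)} = 2 := by
  obtain ⟨χ, hχ⟩ := GenusKolyTransp.quadraticCharacterExists_holds (discr K)
  have hiff := realTrivial_iff_mem_primeTwist_selmerGroup W hΔ hρ hTam h4 hK hodd hH h2K Cd hCd hDEF hSel hχ
  rw [Nat.card_congr (Equiv.subtypeEquivRight hiff)]
  change Nat.card (PrimeTwist.selmerGroup W χ) = 2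
  rw [natCard_primeTwist_selmerGroup_eq_natCard_selmerGroup_rat W (NumberField.discr_ne_zero K) hχ hCd]
  exact_mod_cast hSel

end Frame

/-! ## §3 The real-trivial line CAPITULATES in `K` -/

section Capitulation

variable (W : WeierstrassCurve ℚ) [W.IsElliptic] [W.IsGloballyMinimal] {K : Type} [Field K] [NumberField K]

omit [W.IsElliptic] [W.IsGloballyMinimal] in
/-- **Every class of `Sel_𝔓(A_χ/ℚ)` restricts into the Kummer image `κ₂(E(K))`** (`K ∋ √d`, `Wd = Cd • E^{(d)}` with `rank Wd(ℚ) = 1`, `E(ℚ)[2] = 0`,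
`#Sel₂(Wd) = 2`): by gk2-p5's element-level dictionary `exists_primeTwistModel_dictionary` the class is `ψ_* x` for an `x ∈ Sel₂(Wd/ℚ) = κ(Wd(ℚ))`
(`#κ(Wd(ℚ)) = 2^{rank}·#Wd(ℚ)[2] = 2 = #Sel₂(Wd)`), which lies in `Wd.selmerLocalKer F 2` for EVERY `ℚ`-field `F`, in particular `F = K`; the
dictionary transports this to `PrimeTwist.selmerLocalKer W χ K = W.selmerLocalKer K 2` (`χ` trivial on `Γ_K`: `primeTwist_selmerLocalKer_eq_of_exists_sq`),
and §1 concludes.  BSD is NOT proved by this. [cite: MazurRubin2007, §3, Prop 4.1, Def 4.3] [cite: SilvermanAEC2009, VIII.§2, Thm X.4.2(a)] -/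
theorem resTorsion_mem_range_kummer_of_mem_primeTwist_selmerGroup (hT : NoRationalTwoTorsion W)
    {d : ℤ} (hd0 : d ≠ 0) (hdK : ∃ r : K, r ^ 2 = algebraMap ℚ K (d : ℚ))
    {Wd : WeierstrassCurve ℚ} [Wd.IsElliptic] (Cd : VariableChange ℚ) (hCd : Cd • W.quadraticTwist (d : ℚ) = Wd)
    (hrank : Wd.mordellWeilRank = 1) (hSel : Nat.card (Wd.selmerGroup 2) = 2)
    {χ : absoluteGaloisGroup ℚ →ₜ* Multiplicative (ZMod 2)} (hχ : IsQuadraticCharacterOf χ d)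
    {s : galH1Torsion W ((2 : ℕ) : ℤ)} (hs : s ∈ PrimeTwist.selmerGroup W χ) :
    resTorsion W K ((2 : ℕ) : ℤ) s ∈ (kummerMapTorsion (W.baseChange K) ((2 : ℕ) : ℤ) (hdiv_two_baseChange W K)).range := by
  have hd0' : ((d : ℤ) : ℚ) ≠ 0 := Int.cast_ne_zero.mpr hd0
  -- the element-level dictionary over `ℚ`
  obtain ⟨ψ, hψ, Φ, hΦ, -, hloc⟩ :=
    exists_primeTwistModel_dictionary (K := ℚ) W hd0' hCd χ (smul_geomSqrt_iff_of_isQuadraticCharacterOf hχ)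
  -- `s = ψ_* x` with `x ∈ Sel₂(Wd)`
  obtain ⟨x, hxs⟩ : ∃ x : galH1Torsion Wd ((2 : ℕ) : ℤ), h1Equiv ψ hψ x = s := ⟨_, (h1Equiv ψ hψ).apply_symm_apply s⟩
  have hxSel : x ∈ Wd.selmerGroup ((2 : ℕ) : ℤ) := by
    rw [WeierstrassCurve.mem_selmerGroup_iff]
    have hs' := (PrimeTwist.mem_selmerGroup_iff W χ s).mp hs
    exact ⟨fun v ↦ ((hloc (v.adicCompletion ℚ)).1 x).mpr (by rw [hxs]; exact hs'.1 v),
      fun w ↦ ((hloc w.Completion).1 x).mpr (by rw [hxs]; exact hs'.2 w)⟩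
  -- `Sel₂(Wd) = κ(Wd(ℚ))`: both have two elements
  have hdivd : ∀ P : geomPoints Wd, ∃ Q : geomPoints Wd, ((2 : ℕ) : ℤ) • Q = P :=
    Wd.zsmul_geomPoints_surjective_of_charZero (by norm_num)
  have hTd : NoRationalTwoTorsion Wd := by
    intro u hu
    have hu' := PrimeConductorTwoTorsion.hasRationalTwoTorsionX_smul Wd Cd⁻¹ hu
    rw [← hCd, inv_smul_smul] at hu'
    exact noRationalTwoTorsion_quadraticTwist W hT hd0' _ hu'
  -- (the `DecidableEq ℚ` instance of the generic-field lemmas is the classical one; align ours, as in gk2-p5's `…ShaPlaneDoorTwin`)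
  have hinst : (instDecidableEqRat : DecidableEq ℚ) = fun a b => Classical.propDecidable (a = b) := Subsingleton.elim _ _
  have htors : Nat.card (AddSubgroup.torsionBy Wd.toAffine.Point ((2 : ℕ) : ℤ)) = 1 := by
    have hbot : AddSubgroup.torsionBy Wd.toAffine.Point ((2 : ℕ) : ℤ) = ⊥ :=
      (AddSubgroup.eq_bot_iff_forall _).mpr fun P hP ↦
        Summit.BirchSwinnertonDyer.Rank1Residual.F1Sign2.EggDoubling.eq_zero_of_two_smul_eq_zero _ hTd P
          (AddSubgroup.torsionBy.nsmul_iff.mp hP)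
    rw [hbot, AddSubgroup.card_bot]
  rw [hinst] at htors
  -- from here on, elaborate `Wd(ℚ)` with the classical instance (local instances take precedence)
  letI : DecidableEq ℚ := fun a b => Classical.propDecidable (a = b)
  have hrange := natCard_range_kummerMapTorsion_two_eq_two Wd hdivd hrank htors
  have hle : (kummerMapTorsion Wd ((2 : ℕ) : ℤ) hdivd).range ≤ Wd.selmerGroup ((2 : ℕ) : ℤ) := by
    rintro _ ⟨P, rfl⟩; exact Wd.kummerMapTorsion_mem_selmerGroup ((2 : ℕ) : ℤ) hdivd P
  have hSel' : Nat.card (Wd.selmerGroup ((2 : ℕ) : ℤ)) = 2 := hSel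
  haveI : Finite (Wd.selmerGroup ((2 : ℕ) : ℤ)) := Nat.finite_of_card_ne_zero (by rw [hSel']; norm_num)
  have heq : (kummerMapTorsion Wd ((2 : ℕ) : ℤ) hdivd).range = Wd.selmerGroup ((2 : ℕ) : ℤ) :=
    AddSubgroup.eq_of_le_of_card_ge hle (by rw [hrange, hSel'])
  have hxK : x ∈ (kummerMapTorsion Wd ((2 : ℕ) : ℤ) hdivd).range := by rw [heq]; exact hxSel
  obtain ⟨P, hP⟩ := hxK
  -- `x` lies in the «local» kernel at the GLOBAL field `K`; transport along the dictionary
  have hxKer : x ∈ Wd.selmerLocalKer K ((2 : ℕ) : ℤ) := by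
    rw [← hP]; exact kummerMapTorsion_mem_selmerLocalKer Wd ((2 : ℕ) : ℤ) hdivd K P
  have hsKer : s ∈ W.selmerLocalKer K ((2 : ℕ) : ℤ) := by
    have h := ((hloc K).1 x).mp hxKer
    rw [hxs, primeTwist_selmerLocalKer_eq_of_exists_sq W hχ K hdK] at h
    exact h
  exact resTorsion_mem_range_kummerMapTorsion_of_mem_selmerLocalKer W K ((2 : ℕ) : ℤ) (hdiv_two_baseChange W K) hsKer

end Capitulation


end Summit.BirchSwinnertonDyer.BirchSwinnertonDyer.Theorems.GenusExact.PlusDescent.SocleSelection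

end
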